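import Mathlib

/-!
# Landau's momentum flux `β(A)` in closed form, and `β(A) > 0`

Crux `stmt-NavierStokesRegularity-1944` (`LandauTail.LandauTailBlowup`), line `registered`,
stubs `landauTail_landau_flux_integral` (S5) and `landauTail_landau_flux_pos` (S6).

For Landau's exact solution of the steady Navier–Stokes equations (viscosity `1`, parameter
`A > 1`) the momentum-flux density through the unit sphere, as a function of
`c = cos θ ∈ [-1, 1]`, is `F_A c = U_a c * (u_r c + 1) + c * p c` with
`u_r = 2 ((A² - 1)/(A - c)² - 1)`, `U_a = c u_r + 2 (1 - c²)/(A - c)`,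
`p = 4 (A c - 1)/(A - c)²`.

* `landauTail_landau_flux_integral`: the closed form
  `∫_{-1}^{1} F_A = (8A/3) (3A² + 1)/(A² - 1) - 4A² log ((A + 1)/(A - 1))`
  (Landau 1944; Lemarié-Rieusset 2016, (10.48); Cannone–Karch 2004, (2.4)). Proof: with
  `K = A² - 1`, `F_A c = 4AK²/(A-c)⁴ - 8K²/(A-c)³ + 6AK/(A-c)² - 4A²/(A-c) + 2A`, so
  `G c = 4AK²/(3(A-c)³) - 4K²/(A-c)² + 6AK/(A-c) + 4A² log (A-c) + 2Ac` is an antiderivative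
  on `[-1, 1]`; then FTC-2 and algebra.
* `landauTail_landau_flux_pos`: the right-hand side is `> 0` for `A > 1`. Proof: with
  `x = A⁻¹ ∈ (0, 1)` this says `log ((1 + x)/(1 - x)) < 2x(3 + x²)/(3(1 - x²))`, and the
  difference `k x = 2x(3 + x²)/(3(1 - x²)) - log ((1 + x)/(1 - x))` satisfies `k 0 = 0`,
  `k' x = 2x²(9 - x²)/(3(1 - x²)²) > 0` on `(0, 1)`.

Mathlib only.
-/

set_option linter.dupNamespace false

namespace Summit.NavierStokesRegularity.NavierStokesRegularity.Theorems

open Set MeasureTheory intervalIntegral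

/-- Antiderivative of Landau's flux density (Landau 1944; elementary calculus): for `A - c ≠ 0`
the function `G x = 4AK²/(3(A-x)³) - 4K²/(A-x)² + 6AK/(A-x) + 4A² log (A-x) + 2Ax`
(`K = A² - 1`) has derivative `F_A c = U_a c * (u_r c + 1) + c * p c` at `c`. -/
theorem landauTail_landauFlux_hasDerivAt (A c : ℝ) (hc : A - c ≠ 0) :
    HasDerivAt (fun x => 4 * A * (A ^ 2 - 1) ^ 2 / 3 * ((A - x) ^ 3)⁻¹
        - 4 * (A ^ 2 - 1) ^ 2 * ((A - x) ^ 2)⁻¹ + 6 * A * (A ^ 2 - 1) * (A - x)⁻¹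
        + 4 * A ^ 2 * Real.log (A - x) + 2 * A * x)
      ((c * (2 * ((A ^ 2 - 1) / (A - c) ^ 2 - 1)) + 2 * (1 - c ^ 2) / (A - c)) *
          (2 * ((A ^ 2 - 1) / (A - c) ^ 2 - 1) + 1) + c * (4 * (A * c - 1) / (A - c) ^ 2)) c := by
  have ht : HasDerivAt (fun x => A - x) (-1) c := (hasDerivAt_id' c).const_sub A
  have h3 := ((ht.fun_pow 3).fun_inv (pow_ne_zero 3 hc)).const_mul (4 * A * (A ^ 2 - 1) ^ 2 / 3)
  have h2 := ((ht.fun_pow 2).fun_inv (pow_ne_zero 2 hc)).const_mul (4 * (A ^ 2 - 1) ^ 2)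
  have h1 := (ht.fun_inv hc).const_mul (6 * A * (A ^ 2 - 1))
  have hl := (ht.log hc).const_mul (4 * A ^ 2)
  have hx : HasDerivAt (fun x => 2 * A * x) (2 * A) c := hasDerivAt_const_mul (2 * A)
  refine ((((h3.sub h2).add h1).add hl).add hx).congr_deriv ?_
  field_simp
  ring

/-- **Landau's momentum flux in closed form** (Landau 1944; Lemarié-Rieusset 2016, (10.48);
Cannone–Karch 2004, (2.4)): for `A > 1`,
`∫_{-1}^{1} F_A(c) dc = (8A/3) (3A² + 1)/(A² - 1) - 4A² log ((A + 1)/(A - 1))`, where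
`F_A c = U_a c * (u_r c + 1) + c * p c` is the flux density of Landau's solution through the
unit sphere in the variable `c = cos θ`. -/
theorem landauTail_landau_flux_integral : ∀ A : ℝ, 1 < A → ∫ c in (-1 : ℝ)..1, ((c * (2 * ((A ^ 2 - 1) / (A - c) ^ 2 - 1)) + 2 * (1 - c ^ 2) / (A - c)) * (2 * ((A ^ 2 - 1) / (A - c) ^ 2 - 1) + 1) + c * (4 * (A * c - 1) / (A - c) ^ 2)) = 8 * A / 3 * (3 * A ^ 2 + 1) / (A ^ 2 - 1) - 4 * A ^ 2 * Real.log ((A + 1) / (A - 1)) := by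
  intro A hA
  have hne : ∀ x ∈ uIcc (-1 : ℝ) 1, A - x ≠ 0 := by
    intro x hx
    rw [uIcc_of_le (by norm_num)] at hx
    exact (sub_pos.2 (hx.2.trans_lt hA)).ne'
  have hne2 : ∀ x ∈ uIcc (-1 : ℝ) 1, (A - x) ^ 2 ≠ 0 := fun x hx => pow_ne_zero 2 (hne x hx)
  rw [integral_eq_sub_of_hasDerivAt (fun x hx => landauTail_landauFlux_hasDerivAt A x (hne x hx))
    (ContinuousOn.intervalIntegrable (by fun_prop (disch := assumption)))]
  have hA1 : A - 1 ≠ 0 := (sub_pos.2 hA).ne'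
  have hA2 : 0 < A + 1 := by linarith
  have hA2' : A + 1 ≠ 0 := hA2.ne'
  have hK : A ^ 2 - 1 ≠ 0 := by
    have : 0 < A ^ 2 - 1 := by nlinarith
    exact this.ne'
  simp only [sub_neg_eq_add]
  rw [Real.log_div hA2' hA1]
  field_simp
  ring

/-- Derivative of the comparison function `k x = (6x + 2x³)/(3(1 - x²)) - log ((1 + x)/(1 - x))`
on `(-1, 1)`: `k' y = 2y²(9 - y²)/(3(1 - y²)²)` [elementary calculus]. -/
theorem landauTail_landauFlux_kernel_hasDerivAt (y : ℝ) (hy1 : -1 < y) (hy2 : y < 1) :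
    HasDerivAt
      (fun x : ℝ => (6 * x + 2 * x ^ 3) / (3 * (1 - x ^ 2)) - Real.log ((1 + x) / (1 - x)))
      (2 * y ^ 2 * (9 - y ^ 2) / (3 * (1 - y ^ 2) ^ 2)) y := by
  have h1 : 1 - y ≠ 0 := (sub_pos.2 hy2).ne'
  have h2 : 1 + y ≠ 0 := by
    have : 0 < 1 + y := by linarith
    exact this.ne'
  have h4 : 1 - y ^ 2 ≠ 0 := by
    have : 0 < 1 - y ^ 2 := by nlinarith
    exact this.ne'
  have h3 : 3 * (1 - y ^ 2) ≠ 0 := mul_ne_zero three_ne_zero h4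
  have hn :
      HasDerivAt (fun x : ℝ => 6 * x + 2 * x ^ 3) (6 + 2 * ((3 : ℕ) * y ^ (3 - 1) * 1)) y :=
    (hasDerivAt_const_mul 6).add (((hasDerivAt_id' y).fun_pow 3).const_mul 2)
  have hd : HasDerivAt (fun x : ℝ => 3 * (1 - x ^ 2)) (3 * -((2 : ℕ) * y ^ (2 - 1) * 1)) y :=
    (((hasDerivAt_id' y).fun_pow 2).const_sub 1).const_mul 3
  have hl1 : HasDerivAt (fun x : ℝ => 1 + x) 1 y := (hasDerivAt_id' y).const_add 1
  have hl2 : HasDerivAt (fun x : ℝ => 1 - x) (-1) y := (hasDerivAt_id' y).const_sub 1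
  have hl := (hl1.fun_div hl2 h1).log (div_ne_zero h2 h1)
  refine ((hn.fun_div hd h3).sub hl).congr_deriv ?_
  field_simp
  ring

/-- Positivity of the comparison function: for `x ∈ (0, 1)`,
`log ((1 + x)/(1 - x)) < (6x + 2x³)/(3(1 - x²))`; indeed the difference vanishes at `0` and has
positive derivative `2x²(9 - x²)/(3(1 - x²)²)` on `(0, 1)` [elementary calculus]. -/
theorem landauTail_landauFlux_kernel_pos (x : ℝ) (hx0 : 0 < x) (hx1 : x < 1) :
    0 < (6 * x + 2 * x ^ 3) / (3 * (1 - x ^ 2)) - Real.log ((1 + x) / (1 - x)) := by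
  have hcont : ContinuousOn
      (fun x : ℝ => (6 * x + 2 * x ^ 3) / (3 * (1 - x ^ 2)) - Real.log ((1 + x) / (1 - x)))
      (Ico 0 1) := by
    have h1 : ∀ y ∈ Ico (0 : ℝ) 1, 3 * (1 - y ^ 2) ≠ 0 := by
      intro y hy
      have : 0 < 1 - y ^ 2 := by nlinarith [hy.1, hy.2]
      positivity
    have h2 : ∀ y ∈ Ico (0 : ℝ) 1, 1 - y ≠ 0 := fun y hy => (sub_pos.2 hy.2).ne'
    have h3 : ∀ y ∈ Ico (0 : ℝ) 1, (1 + y) / (1 - y) ≠ 0 := fun y hy =>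
      (div_pos (by linarith [hy.1]) (sub_pos.2 hy.2)).ne'
    fun_prop (disch := assumption)
  have hmono := strictMonoOn_of_deriv_pos (convex_Ico 0 1) hcont (by
    intro y hy
    rw [interior_Ico] at hy
    rw [(landauTail_landauFlux_kernel_hasDerivAt y (by linarith [hy.1]) hy.2).deriv]
    have hy0 : 0 < y := hy.1
    have : 0 < 1 - y ^ 2 := by nlinarith [hy.1, hy.2]
    have : 0 < 9 - y ^ 2 := by nlinarith [hy.1, hy.2]
    positivity)
  have h := hmono (left_mem_Ico.2 one_pos) ⟨hx0.le, hx1⟩ hx0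
  have h0 : (fun x : ℝ => (6 * x + 2 * x ^ 3) / (3 * (1 - x ^ 2)) - Real.log ((1 + x) / (1 - x)))
      0 = 0 := by norm_num
  rw [h0] at h
  exact h

/-- **Positivity of Landau's momentum flux** (Landau 1944; Cannone–Karch 2004, (2.4)): for
`A > 1`, `0 < (8A/3) (3A² + 1)/(A² - 1) - 4A² log ((A + 1)/(A - 1))`, i.e.
`log ((A + 1)/(A - 1)) < 2 (3A² + 1)/(3A (A² - 1))`; substitute `x = A⁻¹` in
`landauTail_landauFlux_kernel_pos`. -/
theorem landauTail_landau_flux_pos : ∀ A : ℝ, 1 < A → 0 < 8 * A / 3 * (3 * A ^ 2 + 1) / (A ^ 2 - 1) - 4 * A ^ 2 * Real.log ((A + 1) / (A - 1)) := by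
  intro A hA
  have hA0 : 0 < A := by linarith
  have hA0' : A ≠ 0 := hA0.ne'
  have hA1 : A - 1 ≠ 0 := (sub_pos.2 hA).ne'
  have hA2 : A + 1 ≠ 0 := by positivity
  have hK0 : 0 < A ^ 2 - 1 := by nlinarith
  have hK : A ^ 2 - 1 ≠ 0 := hK0.ne'
  have hx := landauTail_landauFlux_kernel_pos A⁻¹ (inv_pos.2 hA0) (inv_lt_one_of_one_lt₀ hA)
  have h1 : (1 + A⁻¹) / (1 - A⁻¹) = (A + 1) / (A - 1) := by
    field_simp
  have h2 : (6 * A⁻¹ + 2 * A⁻¹ ^ 3) / (3 * (1 - A⁻¹ ^ 2)) =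
      2 * (3 * A ^ 2 + 1) / (3 * A * (A ^ 2 - 1)) := by
    field_simp
    ring
  rw [h1, h2] at hx
  have key : 8 * A / 3 * (3 * A ^ 2 + 1) / (A ^ 2 - 1) - 4 * A ^ 2 * Real.log ((A + 1) / (A - 1)) =
      4 * A ^ 2 * (2 * (3 * A ^ 2 + 1) / (3 * A * (A ^ 2 - 1)) - Real.log ((A + 1) / (A - 1))) := by
    field_simp
    ring
  rw [key]
  positivity

end Summit.NavierStokesRegularity.NavierStokesRegularity.Theorems
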